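import Literature.Topology.FourManifolds.TrisectionFunctorGKGenusZero
import Summits.SmoothPoincare4.SmoothPoincare4.Theses.CongruenceShadows

/-!
# SmoothPoincare4 / CongruenceShadows — the genus-`0` case (item stmt-SmoothPoincare4-14598)

Settles the support item `GenusZero` of route CongruenceShadows (hypothesis `h0` of its `closes`
theorem): every kernel triple `K : TrisectionKernels 0` in the trivial surface group
`S₀ = π₁(S²)` — in particular every `(0,0)` group trisection of the trivial group in the sense of
Abrams–Gay–Kirby — is stably trivial.

Proof: `S₀` is a subsingleton, so every subgroup of it is `⊤` and `K` is literally the trivial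
triple `trivialKernels` (`Literature.Topology.FourManifolds.TrisectionKernels.eq_trivialKernels`,
Abrams–Gay–Kirby 2018, p. 1538: the unique `(0,0)`-trisection of the trivial group).  One
stabilisation of `trivialKernels` is the genus-`3` `S⁴` triple on the
nose (`Literature.Topology.FourManifolds.trivialKernels_stabilize : trivialKernels.stabilize =
s4Kernels`, Abrams–Gay–Kirby 2018, Def. 3: the `(0,0)` trisection is the unit for the connected
sum `T ↦ T # T_{S⁴,3}`), so the witnesses `n = 1`, `m = 0` with the genus bookkeeping
`3 + 3·0 = 0 + 3·1` (by `rfl`, so the transport `cast` is the identity) and the identity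
automorphism of `S₃` do the job.  The trisection hypothesis `IsGroupTrisection 0 0 PUnit K` is not
needed.

References: A. Abrams, D. Gay, R. Kirby, *Group trisections and smooth 4-manifolds*, Geom. Topol. 22
(2018), p. 1538, Def. 3 (p. 1540) and Thm. 5 [AbramsGayKirby2018].
-/

-- the registered namespace `Summit.SmoothPoincare4.SmoothPoincare4.Theorems` repeats a component
set_option linter.dupNamespace false

namespace Summit.SmoothPoincare4.SmoothPoincare4.Theorems

open Literature.Topology.FourManifolds
open Summit.SmoothPoincare4.SmoothPoincare4.Theses.CongruenceShadows

/-- Settles stmt-SmoothPoincare4-14598 (`CongruenceShadows.GenusZero`): every `(0,0)` group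
trisection of the trivial group — indeed every kernel triple in `S₀` — is stably trivial.
Proof: `K = trivialKernels` (`TrisectionKernels.eq_trivialKernels`), and one stabilisation gives
`s4Kernels` on the nose (`trivialKernels_stabilize`), so `⟨n, m, h⟩ = ⟨1, 0, rfl⟩` with the
identity isomorphism works.
[cite: AbramsGayKirby2018, Def. 3 (p. 1540)] -/
theorem GenusZero_proof :
    Summit.SmoothPoincare4.SmoothPoincare4.Theses.CongruenceShadows.GenusZero := by
  unfold GenusZero
  intro K _
  obtain rfl : K = trivialKernels := K.eq_trivialKernels
  refine ⟨1, 0, rfl, ?_⟩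
  show TrisectionKernels.Iso trivialKernels.stabilize s4Kernels
  rw [trivialKernels_stabilize]
  exact TrisectionKernels.Iso.refl _

end Summit.SmoothPoincare4.SmoothPoincare4.Theorems
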